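import Literature.Analysis.FluidPDE.TorusNSPressureGradientCriterion
import Literature.Analysis.FunctionSpaces.TorusSobolevGagliardoNirenberg
import HarnessLib

/-!
# The pressure-Hessian form of the Berselli–Galdi pressure-gradient criterion on `T³`:
  `∇²p ∈ L^r(0,T; L^q)`, `2/r + 3/q = 4`, `1 ≤ q ≤ 3/2`

search for candidate a priori estimates; no regularity claim (cell `pub-nsfunc`, literature seat:
this file types PUBLISHED results and their immediate combination, nothing new).

Analysis/FluidPDE file (everything proved; no definitions, no named facts). Berselli–Galdi 2002,
Thm 3.3 is the regularity criterion `∇p ∈ L^r(0,T; L^s)`, `2/r + 3/s = 3`, `s ∈ (9/7, 3]`, typed on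
the flat three-torus in continuation form for classical solutions in
`TorusNSPressureGradientCriterion` (`Torus.classicalNS_continuation_of_pressureGradientLs_rpow_integral_le`).
Transporting its hypothesis through the Sobolev embedding `W^{2,q}(𝕋³) ⊂ W^{1,q*}(𝕋³)`,
`q* = 3q/(3−q)` (Robinson–Rodrigo–Sadowski 2016, Thm 1.7 (i) with Thm 1.9 (iii): each `∂ᵢp` has
zero mean on the torus; `TorusSobolevGagliardoNirenberg`) gives the same criterion with the
PRESSURE HESSIAN in place of the pressure gradient, at the scaling-critical line `2/r + 3/q = 4`
(`r = 2q/(4q−3)`; `s = q* ∈ [3/2, 3]` exactly when `1 ≤ q ≤ 3/2`):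

* `Torus.exists_gradientLs_le_hessianLq` — the static Sobolev step on `T³`:
  `(∫‖∇f‖^s)^{1/s} ≤ C (∫(∑ᵢⱼ(∂ⱼ∂ᵢf)²)^{q/2})^{1/q}` for smooth real `f`, `1 ≤ q < 3`, `1 ≤ s`,
  `1/q − 1/3 ≤ 1/s` (componentwise zero-mean Sobolev inequality
  `Torus.exists_integral_partialDeriv_rpow_le_hessian` and Minkowski over the components);
* `Torus.classicalNS_continuation_of_pressureHessianLq_rpow_integral_le` — **the criterion**: a
  classical mean-zero solution on `[0, T) × T³` with a continuous majorant `N(t)` of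
  `‖∇²p(t)‖_{L^q}` (Frobenius norm of the Hessian), `∫₀ᵗ N^{2q/(4q−3)} ≤ I` for all `t < T`,
  `1 ≤ q ≤ 3/2`, continues past `T` (the `q = 3/2` endpoint is `∇²p ∈ L¹(0,T; L^{3/2})`,
  transported to Berselli–Galdi's limit case `∇p ∈ L¹(0,T; L³)`, Remark 3.4).

This is the CRITERION column for the dictionary rows `EP.Pidev.q` (`q = 3/2`: `r = 1`) next to
the energy-class BUDGET `∫₀ᵀ‖∂ᵢ∂ⱼp‖_q^{q/(4q−3)} ≤ …` of `TorusNSPressureGradientBudget`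
(`Torus.exists_classicalNS_integral_pressureHessianLs_rpow_le`): exponent gap `r/θ = 2`, as on
every energy-class row. No separate printed pressure-Hessian criterion is claimed: the statement
is Berselli–Galdi's Thm 3.3 composed with the Sobolev embedding, and is labelled so.

## Mathlib / tree search

Tree: `TorusNSPressureGradientCriterion` (the `∇p` criterion, `9/7 < s ≤ 3`),
`TorusNSPressureGradientBudget` (Hessian identities `Δp = −∑∂ᵢuⱼ∂ⱼuᵢ`, CZ bound, budget),
`TorusSobolevGagliardoNirenberg` (`W^{1,p} ⊂ L^{p*}` on `T^d`). Searched
`pressureHessian.*continuation|hessian.*criterion` under `Literature/`: nothing.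
Literature search (corpus + Crossref/arXiv/zbMATH, 2026-08-20; OpenAlex/S2 rate-limited):
pressure criteria in print are stated for `p` (Chae–Lee 2001, Berselli–Galdi 2002 Thm 1.1,
Struwe 2007) or `∇p` (Berselli–Galdi Thm 3.3, Zhou 2006, Bosia–Conti–Pata 2014); no `∇²p` form
was found, hence the combination label.

## References

* L. C. Berselli, G. P. Galdi, *Regularity criteria involving the pressure for the weak solutions
  to the Navier–Stokes equations*, Proc. AMS 130 (2002) 3585–3595, Thm 3.3 and Remark 3.4.
  [`BerselliGaldi2002`]
* J. C. Robinson, J. L. Rodrigo, W. Sadowski, *The Three-Dimensional Navier–Stokes Equations*,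
  CUP 2016, Thm 1.7 (i), Thm 1.9 (iii) (Sobolev embedding and Poincaré on `𝕋³`).
  [`RobinsonRodrigoSadowskiCUP2016`]
-/

noncomputable section

open Set MeasureTheory intervalIntegral Filter Real
open scoped ContDiff InnerProductSpace RealInnerProductSpace Topology ENNReal NNReal

namespace Literature.Analysis.FluidPDE

open Literature.Analysis.FunctionSpaces

variable {d : Type*} [Fintype d] [DecidableEq d]

/-! ### The static Sobolev step `‖∇f‖_{L^s} ≤ C ‖∇²f‖_{L^q}` on `T³` -/

omit [DecidableEq d] in
/-- Minkowski in Bochner form on the torus: for continuous nonnegative `g, g₁, …` with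
`g ≤ ∑ₖ gₖ` pointwise and `1 ≤ s`, `(∫ g^s)^{1/s} ≤ ∑ₖ (∫ gₖ^s)^{1/s}` (`eLpNorm_sum_le` and the
Bochner form of `eLpNorm` for continuous functions on the compact torus). [folklore] -/
private theorem integral_rpow_le_sum_of_le_sum {ι : Type*} [Fintype ι] {s : ℝ} (hs : 1 ≤ s)
    {g : UnitAddTorus d → ℝ} {G : ι → UnitAddTorus d → ℝ} (hgc : Continuous g)
    (hGc : ∀ k, Continuous (G k)) (hg0 : ∀ x, 0 ≤ g x) (hG0 : ∀ k x, 0 ≤ G k x)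
    (hle : ∀ x, g x ≤ ∑ k, G k x) :
    (∫ x, g x ^ s) ^ (1 / s) ≤ ∑ k, (∫ x, G k x ^ s) ^ (1 / s) := by
  have hs0 : 0 < s := by linarith
  set pr : ℝ≥0∞ := ENNReal.ofReal s with hpr
  have hp1 : 1 ≤ pr := by rw [hpr]; exact ENNReal.one_le_ofReal.2 hs
  have hp0 : pr ≠ 0 := (zero_lt_one.trans_le hp1).ne'
  have hptop : pr ≠ ⊤ := ENNReal.ofReal_ne_top
  have htoReal : pr.toReal = s := ENNReal.toReal_ofReal hs0.le
  have conv : ∀ {φ : UnitAddTorus d → ℝ}, Continuous φ → (∀ x, 0 ≤ φ x) →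
      eLpNorm φ pr volume = ENNReal.ofReal ((∫ x, φ x ^ s) ^ (1 / s)) := by
    intro φ hφ hφ0
    rw [MemLp.eLpNorm_eq_integral_rpow_norm hp0 hptop
      (hφ.memLp_of_hasCompactSupport (HasCompactSupport.of_compactSpace φ)), htoReal, one_div]
    congr 2
    exact integral_congr_ae (ae_of_all _ fun x => by
      simp only [Real.norm_eq_abs, abs_of_nonneg (hφ0 x)])
  have h1 : eLpNorm g pr volume ≤ ∑ k, eLpNorm (G k) pr volume := by
    have hle' : eLpNorm g pr volume ≤ eLpNorm (fun x => ∑ k, G k x) pr volume :=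
      eLpNorm_mono_real fun x => by
        rw [Real.norm_eq_abs, abs_of_nonneg (hg0 x)]
        exact hle x
    have e : (fun x => ∑ k, G k x) = ∑ k, G k := by
      funext x
      simp only [Finset.sum_apply]
    rw [e] at hle'
    exact hle'.trans (eLpNorm_sum_le (fun k _ => (hGc k).aestronglyMeasurable) hp1)
  rw [conv hgc hg0] at h1
  have e2 : ∑ k, eLpNorm (G k) pr volume = ENNReal.ofReal (∑ k, (∫ x, G k x ^ s) ^ (1 / s)) := by
    rw [ENNReal.ofReal_sum_of_nonneg fun k _ =>
      Real.rpow_nonneg (integral_nonneg fun x => Real.rpow_nonneg (hG0 k x) _) _]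
    exact Finset.sum_congr rfl fun k _ => conv (hGc k) (hG0 k)
  rw [e2] at h1
  exact (ENNReal.ofReal_le_ofReal_iff (Finset.sum_nonneg fun k _ =>
    Real.rpow_nonneg (integral_nonneg fun x => Real.rpow_nonneg (hG0 k x) _) _)).1 h1

/-- **`‖∇f‖_{L^s(T³)} ≤ C ‖∇²f‖_{L^q(T³)}` for smooth real `f`** (the Sobolev embedding
`W^{2,q}(𝕋³) ⊂ W^{1,q*}(𝕋³)`, Robinson–Rodrigo–Sadowski 2016 Thm 1.7 (i) with the Poincaré
inequality Thm 1.9 (iii) for the zero-mean derivatives `∂ᵢf`): on `T^d`, `card d = 3`, for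
`1 ≤ q < 3`, `1 ≤ s`, `1/q − 1/3 ≤ 1/s` there is `C ≥ 0` with
`(∫ ‖∇f‖^s)^{1/s} ≤ C (∫ (∑ᵢ∑ⱼ (∂ⱼ∂ᵢf)²)^{q/2})^{1/q}` for every smooth `f : T^d → ℝ`
(`‖∇f‖ ≤ ∑ᵢ|∂ᵢf|`, Minkowski, `Torus.exists_integral_partialDeriv_rpow_le_hessian` for each `i`,
and `(∑ⱼ(∂ⱼ∂ᵢf)²)^{q/2} ≤ (∑ᵢ'∑ⱼ(∂ⱼ∂ᵢ'f)²)^{q/2}`).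
[cite: RobinsonRodrigoSadowskiCUP2016, Thm 1.7 (i) and Thm 1.9 (iii)] -/
theorem Torus.exists_gradientLs_le_hessianLq (hd : Fintype.card d = 3) {q s : ℝ} (hq : 1 ≤ q)
    (hq3 : q < 3) (hs : 1 ≤ s) (hqs : 1 / q - 1 / 3 ≤ 1 / s) :
    ∃ C : ℝ, 0 ≤ C ∧ ∀ f : UnitAddTorus d → ℝ, Torus.IsSmooth f →
      (∫ x, ‖Torus.gradient f x‖ ^ s) ^ (1 / s) ≤
        C * (∫ x, (∑ i, ∑ j, Torus.partialDeriv j (Torus.partialDeriv i f) x ^ 2) ^ (q / 2)) ^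
          (1 / q) := by
  have hs0 : 0 < s := by linarith
  have hq0 : 0 < q := by linarith
  obtain ⟨C₀, hC₀0, hC₀⟩ :=
    Torus.exists_integral_partialDeriv_rpow_le_hessian (d := d) (F' := ℝ) hd hq hq3 hs0 hqs
  refine ⟨Fintype.card d * C₀, by positivity, fun f hf => ?_⟩
  have hf1 : Torus.IsContDiff 1 f := hf.isContDiff (by simp)
  set H : UnitAddTorus d → ℝ :=
    fun x => ∑ i, ∑ j, Torus.partialDeriv j (Torus.partialDeriv i f) x ^ 2 with hH
  set B : ℝ := (∫ x, H x ^ (q / 2)) ^ (1 / q) with hB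
  have hH0 : ∀ x, 0 ≤ H x := fun x =>
    Finset.sum_nonneg fun i _ => Finset.sum_nonneg fun j _ => sq_nonneg _
  have hB0 : 0 ≤ B := Real.rpow_nonneg (integral_nonneg fun x => Real.rpow_nonneg (hH0 x) _) _
  have hD2c : ∀ i j, Continuous (Torus.partialDeriv j (Torus.partialDeriv i f)) :=
    fun i j => ((hf.partialDeriv i).partialDeriv j).continuous
  have hHc : Continuous H :=
    continuous_finsetSum _ fun i _ => continuous_finsetSum _ fun j _ => (hD2c i j).pow 2
  -- each component: `(∫|∂ᵢf|^s)^{1/s} ≤ C₀ B`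
  have hcomp : ∀ i, (∫ x, |Torus.partialDeriv i f x| ^ s) ^ (1 / s) ≤ C₀ * B := by
    intro i
    have h1 := hC₀ f hf i
    have e1 : (fun x => ‖Torus.partialDeriv i f x‖ ^ s) = fun x => |Torus.partialDeriv i f x| ^ s := by
      funext x; rw [Real.norm_eq_abs]
    rw [e1] at h1
    refine h1.trans (mul_le_mul_of_nonneg_left ?_ hC₀0)
    -- `(∫ √(∑ⱼ‖∂ⱼ∂ᵢf‖²)^q)^{1/q} ≤ B`
    have hHi : ∀ x, Real.sqrt (∑ j, ‖Torus.partialDeriv j (Torus.partialDeriv i f) x‖ ^ 2) ^ q ≤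
        H x ^ (q / 2) := by
      intro x
      have e : ∑ j, ‖Torus.partialDeriv j (Torus.partialDeriv i f) x‖ ^ 2 =
          ∑ j, Torus.partialDeriv j (Torus.partialDeriv i f) x ^ 2 :=
        Finset.sum_congr rfl fun j _ => by rw [Real.norm_eq_abs, sq_abs]
      rw [e, Real.sqrt_eq_rpow, ← Real.rpow_mul (Finset.sum_nonneg fun j _ => sq_nonneg _),
        show (1 : ℝ) / 2 * q = q / 2 by ring]
      refine Real.rpow_le_rpow (Finset.sum_nonneg fun j _ => sq_nonneg _) ?_ (by positivity)
      rw [hH]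
      exact Finset.single_le_sum (f := fun i' => ∑ j, Torus.partialDeriv j
        (Torus.partialDeriv i' f) x ^ 2) (fun i' _ => Finset.sum_nonneg fun j _ => sq_nonneg _)
        (Finset.mem_univ i)
    have hGic : Continuous fun x =>
        Real.sqrt (∑ j, ‖Torus.partialDeriv j (Torus.partialDeriv i f) x‖ ^ 2) ^ q :=
      (Real.continuous_sqrt.comp (continuous_finsetSum _ fun j _ =>
        ((hD2c i j).norm).pow 2)).rpow_const fun x => Or.inr hq0.le
    have hint : ∫ x, Real.sqrt (∑ j, ‖Torus.partialDeriv j (Torus.partialDeriv i f) x‖ ^ 2) ^ q ≤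
        ∫ x, H x ^ (q / 2) :=
      integral_mono_of_nonneg (ae_of_all _ fun x => Real.rpow_nonneg (Real.sqrt_nonneg _) _)
        ((hHc.rpow_const fun x => Or.inr (by positivity)).integrable_unitAddTorus)
        (ae_of_all _ hHi)
    exact Real.rpow_le_rpow (integral_nonneg fun x => Real.rpow_nonneg (Real.sqrt_nonneg _) _)
      hint (by positivity)
  -- `‖∇f‖ ≤ ∑ᵢ |∂ᵢf|` and Minkowski
  have hgrad : ∀ x, ‖Torus.gradient f x‖ ≤ ∑ i, |Torus.partialDeriv i f x| := by
    intro x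
    rw [Torus.gradient_eq_sum_partialDeriv hf1 x]
    refine (norm_sum_le _ _).trans (le_of_eq (Finset.sum_congr rfl fun i _ => ?_))
    rw [norm_smul, PiLp.norm_single, norm_one, mul_one, Real.norm_eq_abs]
  have hMink := integral_rpow_le_sum_of_le_sum (d := d) hs (g := fun x => ‖Torus.gradient f x‖)
    (G := fun i x => |Torus.partialDeriv i f x|) hf.gradient.continuous.norm
    (fun i => (hf.partialDeriv i).continuous.abs) (fun x => norm_nonneg _)
    (fun i x => abs_nonneg _) hgrad
  calc (∫ x, ‖Torus.gradient f x‖ ^ s) ^ (1 / s)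
      ≤ ∑ i, (∫ x, |Torus.partialDeriv i f x| ^ s) ^ (1 / s) := hMink
    _ ≤ ∑ _i : d, C₀ * B := Finset.sum_le_sum fun i _ => hcomp i
    _ = Fintype.card d * C₀ * B := by rw [Finset.sum_const, Finset.card_univ, nsmul_eq_mul]; ring

/-! ### The criterion -/

/-- **The Berselli–Galdi pressure criterion in pressure-Hessian form on `T³` (continuation form),
`∇²p ∈ L^r(0,T; L^q)`, `2/r + 3/q = 4`, `1 ≤ q ≤ 3/2`.** Berselli–Galdi 2002, Thm 3.3 (`∇p ∈
L^{r}(0,T; L^s)`, `2/r + 3/s = 3`, `s ∈ (9/7, 3]`, Remark 3.4 for the limit case `L¹(0,T; L³)`),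
composed with the Sobolev embedding `W^{2,q}(𝕋³) ⊂ W^{1,s}(𝕋³)`, `s = q* = 3q/(3−q)`
(Robinson–Rodrigo–Sadowski 2016, Thm 1.7 (i) + Thm 1.9 (iii); `Torus.exists_gradientLs_le_hessianLq`):
let `(u, p)` be a classical solution of the unforced Navier–Stokes equations with `ν > 0` on
`[0, T) × T^d`, `card d = 3`, `T > 0`, with mean-zero velocity slices, and let `N` be a continuous
nonnegative majorant of the `L^q` norm of the pressure Hessian,
`(∫ (∑ᵢⱼ (∂ⱼ∂ᵢp(t))²)^{q/2})^{1/q} ≤ N(t)`, with `∫₀ᵗ N^{2q/(4q−3)} ≤ I` for all `t ∈ [0, T)`.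
Then the solution continues to a classical mean-zero solution on some `[0, T'] × T^d`, `T' > T`,
equal to `u` on `[0, T)`. (`2/r + 3/q = 4` with `r = 2q/(4q−3)`: the scaling-critical line for
second derivatives of the pressure; `q = 3/2` gives `r = 1`.) A COMBINATION of the two cited
results — no separate printed pressure-Hessian criterion is claimed.
[cite: BerselliGaldi2002, Thm 3.3 (p. 3593) and Remark 3.4] -/
theorem Torus.classicalNS_continuation_of_pressureHessianLq_rpow_integral_le
    (hd : Fintype.card d = 3) {ν T q : ℝ} (hν : 0 < ν) (hT : 0 < T) (hq : 1 ≤ q) (hq2 : q ≤ 3 / 2)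
    {u : ℝ → UnitAddTorus d → EuclideanSpace ℝ d} {p : ℝ → UnitAddTorus d → ℝ}
    (h : Torus.IsClassicalNSSolutionOn (Ico 0 T) ν 0 u p)
    (hmean : ∀ t ∈ Ico 0 T, Torus.HasZeroMean (u t)) {N : ℝ → ℝ}
    (hNc : ContinuousOn N (Ico 0 T)) (hN0 : ∀ t ∈ Ico 0 T, 0 ≤ N t)
    (hN : ∀ t ∈ Ico 0 T,
      (∫ x, (∑ i, ∑ j, Torus.partialDeriv j (Torus.partialDeriv i (p t)) x ^ 2) ^ (q / 2)) ^
          (1 / q) ≤ N t)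
    {I : ℝ} (hI : ∀ t ∈ Ico 0 T, ∫ τ in (0 : ℝ)..t, N τ ^ (2 * q / (4 * q - 3)) ≤ I) :
    ∃ T' : ℝ, T < T' ∧ ∃ (u' : ℝ → UnitAddTorus d → EuclideanSpace ℝ d)
      (p' : ℝ → UnitAddTorus d → ℝ), Torus.IsClassicalNSSolutionOn (Icc 0 T') ν 0 u' p' ∧
        (∀ t ∈ Icc 0 T', Torus.HasZeroMean (u' t)) ∧ ∀ t ∈ Ico 0 T, u' t = u t := by
  have hq0 : 0 < q := by linarith
  have h3q : 0 < 3 - q := by linarith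
  have h4q : 0 < 4 * q - 3 := by linarith
  set s : ℝ := 3 * q / (3 - q) with hs_def
  have hs1 : 1 ≤ s := by
    rw [hs_def, le_div_iff₀ h3q]; linarith
  have hs97 : 9 / 7 < s := by
    rw [hs_def, lt_div_iff₀ h3q]; linarith
  have hs3 : s ≤ 3 := by
    rw [hs_def, div_le_iff₀ h3q]; linarith
  have hqs : 1 / q - 1 / 3 ≤ 1 / s := by
    rw [hs_def]
    have e : 1 / q - 1 / 3 = 1 / (3 * q / (3 - q)) := by field_simp
    rw [e]
  have hexp : 2 * s / (3 * (s - 1)) = 2 * q / (4 * q - 3) := by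
    rw [hs_def]
    have hs1' : 3 * q / (3 - q) - 1 = (4 * q - 3) / (3 - q) := by field_simp; ring
    rw [hs1']
    field_simp
  obtain ⟨C, hC0, hC⟩ := Torus.exists_gradientLs_le_hessianLq (d := d) hd hq (by linarith) hs1 hqs
  set r : ℝ := 2 * q / (4 * q - 3) with hr_def
  have hr0 : 0 ≤ r := by rw [hr_def]; positivity
  -- the transported majorant `C · N`
  have hN' : ∀ t ∈ Ico 0 T, (∫ x, ‖Torus.gradient (p t) x‖ ^ s) ^ (1 / s) ≤ C * N t := by
    intro t ht
    have hpt : Torus.IsSmooth (p t) := h.smooth_pressure.isSmooth_slice ht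
    exact (hC (p t) hpt).trans (mul_le_mul_of_nonneg_left (hN t ht) hC0)
  have hI' : ∀ t ∈ Ico 0 T, ∫ τ in (0 : ℝ)..t, (C * N τ) ^ (2 * s / (3 * (s - 1))) ≤ C ^ r * I := by
    intro t ht
    rw [hexp]
    have e : ∫ τ in (0 : ℝ)..t, (C * N τ) ^ r = ∫ τ in (0 : ℝ)..t, C ^ r * N τ ^ r := by
      refine intervalIntegral.integral_congr fun τ hτ => ?_
      rw [uIcc_of_le ht.1] at hτ
      have hτ' : τ ∈ Ico 0 T := ⟨hτ.1, hτ.2.trans_lt ht.2⟩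
      rw [Real.mul_rpow hC0 (hN0 τ hτ')]
    rw [e, intervalIntegral.integral_const_mul]
    exact mul_le_mul_of_nonneg_left (hI t ht) (Real.rpow_nonneg hC0 _)
  exact Torus.classicalNS_continuation_of_pressureGradientLs_rpow_integral_le hd hν hT hs97 hs3 h
    hmean (N := fun t => C * N t) (continuousOn_const.mul hNc)
    (fun t ht => mul_nonneg hC0 (hN0 t ht)) hN' hI'

end Literature.Analysis.FluidPDE
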